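import Mathlib
import Summits.PneNP.PneNP.Theorems.OverlapGapAlgebraSolvableImpliesStableSectionMeanSquareTransferVariance
import Summits.PneNP.PneNP.Theorems.OverlapGapAlgebraSolvableImpliesStableSectionLipschitzTransferTypicalBoost

/-!
# PneNP / OverlapGapAlgebra — crux `SolvableImpliesStableSection` (stmt-PneNP-2463):
# the MEAN-SQUARE (ℓ²-stable) transfer (2/3) — validity boost and numerics

Support for crux `stmt-PneNP-2463` (`Summit.PneNP.PneNP.Theses.OverlapGapAlgebra.SolvableImpliesStableSection`).
Continuation of `…MeanSquareTransferVariance`: for a map `g : instances → assignments` with mean-square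
single-literal-resample sensitivity `S(g) ≤ s₂ · (k m) · #Inst · 2n`,

* `sissMS_km_card_invalid_le` — the VALIDITY half at fixed `k, m, n`: if `g` satisfies at least
  `ε·#Inst` instances, the exceptional set `{Φ : L < D Φ}` has `m²·#Bad ≤ #Inst`, and
  `8k(2 + L² s₂) ≤ ε ν² m`, then `G = {Φ : V_g Φ ≤ ν m}` has `(k m)·#Gᶜ ≤ 4k·k(2 + L² s₂)/ν² · #Inst`
  (literal Efron–Stein `sissMS_sum_sq_dev_le` + boost/Chebyshev `shwLip_card_gt_le_of_zeroSet`);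
* `sissMS_numerics` — the five numerical facts the walk engine needs at a large `n`, from
  `s₂(n) log³ n ≤ δ n` with an explicit small `δ`: `m ≥ 1`, the jump budget `s₂·(m k) ≤ (η n)²`, the
  boost condition, and the growing-loss conditions `log 2 + 4kA log(2n) ≤ c n`, `4kA + 1 ≤ m k²` for the
  loss rate `A = 4k·k(2 + 9 s₂ log² n)/ν² + 1`.
No new definitions; axioms `propext`, `Classical.choice`, `Quot.sound`.
-/

set_option linter.dupNamespace false -- `Summit.PneNP.PneNP.…`: summit = sub-problem (D-0017)

namespace Summit.PneNP.PneNP.Theorems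

open Finset Filter
open scoped Classical

section Boost

variable {m k n : ℕ}

/-- **Validity half of the mean-square transfer (fixed `k, m, n`).** Let `g` have mean-square
single-literal-resample sensitivity `∑_{(a,b)} ∑_{(Φ,ℓ)} d_H(g Φ, g Φ[(a,b) ↦ ℓ])² ≤ s₂·(m k)·#Inst·2n`
(`0 ≤ s₂`), let `m²·#{Φ : L < D Φ} ≤ #Inst`, let `g` satisfy at least `ε·#Inst` instances, and let
`8k(2 + L² s₂) ≤ ε ν² m`. Then `G = {Φ : V_g Φ ≤ ν m}` has `(k m)·#Gᶜ ≤ 4k·k(2 + L² s₂)/ν² · #Inst`. -/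
theorem sissMS_km_card_invalid_le (hn : 1 ≤ n) (hm : 1 ≤ m)
    (g : (Fin m → Fin k → Fin n × Bool) → (Fin n → Bool)) (s₂ ν ε : ℝ) (hs : 0 ≤ s₂)
    (hν : 0 < ν) (hε : 0 < ε) (L : ℕ)
    (hS : (∑ a : Fin m, ∑ b : Fin k, ∑ p : (Fin m → Fin k → Fin n × Bool) × (Fin n × Bool),
        (hammingDist (g p.1) (g (Function.update p.1 a (Function.update (p.1 a) b p.2))) : ℝ) ^ 2)
      ≤ s₂ * (((m * k : ℕ) : ℝ) * (Fintype.card (Fin m → Fin k → Fin n × Bool) * (2 * n))))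
    (hBad : (m : ℝ) ^ 2 * (((univ : Finset (Fin m → Fin k → Fin n × Bool)).filter fun Φ =>
        L < (univ : Finset (Fin n)).sup fun v =>
          ((univ : Finset (Fin m)).filter fun i => ∃ j, (Φ i j).1 = v).card).card : ℝ)
      ≤ Fintype.card (Fin m → Fin k → Fin n × Bool))
    (hsucc : ε * Fintype.card (Fin m → Fin k → Fin n × Bool) ≤
      ((Finset.univ.filter fun Φ : Fin m → Fin k → Fin n × Bool =>
        ∀ i, ∃ j, g Φ (Φ i j).1 = (Φ i j).2).card : ℝ))
    (h8B : 8 * (k * (2 + (L : ℝ) ^ 2 * s₂)) ≤ ε * ν ^ 2 * m)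
    (G : Finset (Fin m → Fin k → Fin n × Bool))
    (hGdef : G = (univ : Finset (Fin m → Fin k → Fin n × Bool)).filter fun Φ =>
      ((((univ : Finset (Fin m)).filter fun i => ∀ j, g Φ (Φ i j).1 ≠ (Φ i j).2).card : ℕ) : ℝ)
        ≤ ν * m) :
    ((k * m : ℕ) : ℝ) * (Gᶜ.card : ℝ)
      ≤ 4 * k * (k * (2 + (L : ℝ) ^ 2 * s₂)) / ν ^ 2 * Fintype.card (Fin m → Fin k → Fin n × Bool) := by
  haveI : Nonempty (Fin n × Bool) := ⟨(⟨0, hn⟩, true)⟩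
  have hmR : (1 : ℝ) ≤ m := by exact_mod_cast hm
  have hmpos' : (0 : ℝ) < m := by linarith only [hmR]
  have hnR : (1 : ℝ) ≤ n := by exact_mod_cast hn
  have hnpos : (0 : ℝ) < n := by linarith only [hnR]
  -- the literal Efron–Stein variance bound (before abbreviating)
  have hW2 := sissMS_sum_sq_dev_le (m := m) (k := k) hn g L
  set N : ℝ := (Fintype.card (Fin m → Fin k → Fin n × Bool) : ℝ) with hN
  have hNpos : 0 < N := by rw [hN]; exact_mod_cast Fintype.card_pos
  set S : ℝ := ∑ a : Fin m, ∑ b : Fin k, ∑ p : (Fin m → Fin k → Fin n × Bool) × (Fin n × Bool),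
      (hammingDist (g p.1) (g (Function.update p.1 a (Function.update (p.1 a) b p.2))) : ℝ) ^ 2
    with hSdef
  set Bad : ℝ := (((univ : Finset (Fin m → Fin k → Fin n × Bool)).filter fun Φ =>
      L < (univ : Finset (Fin n)).sup fun v =>
        ((univ : Finset (Fin m)).filter fun i => ∃ j, (Φ i j).1 = v).card).card : ℝ) with hBadDef
  set W : ℝ := ∑ Φ : Fin m → Fin k → Fin n × Bool,
      ((((univ : Finset (Fin m)).filter fun i => ∀ j, g Φ (Φ i j).1 ≠ (Φ i j).2).card : ℝ)
        - (∑ Ψ : Fin m → Fin k → Fin n × Bool,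
            (((univ : Finset (Fin m)).filter fun i => ∀ j, g Ψ (Ψ i j).1 ≠ (Ψ i j).2).card : ℝ)) / N) ^ 2
    with hWdef
  set B : ℝ := k * (2 + (L : ℝ) ^ 2 * s₂) with hB
  have hk0 : (0 : ℝ) ≤ k := Nat.cast_nonneg _
  have hBnn : 0 ≤ B := by rw [hB]; positivity
  -- `W ≤ m N B`
  have hLS : (L : ℝ) ^ 2 * S ≤ (L : ℝ) ^ 2 * (s₂ * (((m * k : ℕ) : ℝ) * (N * (2 * n)))) :=
    mul_le_mul_of_nonneg_left hS (sq_nonneg _)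
  have hB3 : (m : ℝ) ^ 2 * (((m * k : ℕ) : ℝ) * n) * Bad ≤ (((m * k : ℕ) : ℝ) * n) * N := by
    calc (m : ℝ) ^ 2 * (((m * k : ℕ) : ℝ) * n) * Bad = (((m * k : ℕ) : ℝ) * n) * ((m : ℝ) ^ 2 * Bad) := by
          ring
      _ ≤ (((m * k : ℕ) : ℝ) * n) * N := mul_le_mul_of_nonneg_left hBad (by positivity)
  have h2n : (2 * n : ℝ) * W ≤ (2 * n) * (m * N * B) := by
    have h1 : (2 * n : ℝ) * W ≤ ((m * k : ℕ) : ℝ) * N * (2 * n)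
        + (L : ℝ) ^ 2 * (s₂ * (((m * k : ℕ) : ℝ) * (N * (2 * n)))) + (((m * k : ℕ) : ℝ) * n) * N :=
      hW2.trans (add_le_add (add_le_add le_rfl hLS) hB3)
    have hx : 0 ≤ (m : ℝ) * k * n * N := by positivity
    have h2 : ((m * k : ℕ) : ℝ) * N * (2 * n)
        + (L : ℝ) ^ 2 * (s₂ * (((m * k : ℕ) : ℝ) * (N * (2 * n)))) + (((m * k : ℕ) : ℝ) * n) * N
        ≤ (2 * n) * (m * N * B) := by
      rw [hB]; push_cast; nlinarith [hx]
    exact h1.trans h2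
  have hWB : W ≤ m * N * B := le_of_mul_le_mul_left h2n (by positivity)
  -- (E1) the boost condition `4 W ≤ (ε/2) N (ν m)²`
  have hE1 : 4 * W ≤ ε / 2 * N * (ν * m) ^ 2 := by
    calc 4 * W ≤ 4 * (m * N * B) := by linarith only [hWB]
      _ = (m * N) * (4 * B) := by ring
      _ ≤ (m * N) * (ε * ν ^ 2 * m / 2) := by
          apply mul_le_mul_of_nonneg_left _ (by positivity)
          rw [hB]; linarith only [h8B]
      _ = ε / 2 * N * (ν * m) ^ 2 := by ring
  -- the zero set of `V_g` contains the solved instances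
  have hZ : ∀ Φ ∈ ((univ : Finset (Fin m → Fin k → Fin n × Bool)).filter
      fun Φ => ∀ i, ∃ j, g Φ (Φ i j).1 = (Φ i j).2),
      (fun Ψ : Fin m → Fin k → Fin n × Bool =>
        ((((univ : Finset (Fin m)).filter fun i => ∀ j, g Ψ (Ψ i j).1 ≠ (Ψ i j).2).card : ℕ) : ℝ)) Φ
        = 0 := by
    intro Φ hΦ
    simp only [mem_filter, mem_univ, true_and] at hΦ
    simp only [Nat.cast_eq_zero, Finset.card_eq_zero, Finset.filter_eq_empty_iff]
    intro i _ hall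
    obtain ⟨j, hj⟩ := hΦ i
    exact hall j hj
  have hV0 : ∀ Φ : Fin m → Fin k → Fin n × Bool, 0 ≤ (fun Ψ : Fin m → Fin k → Fin n × Bool =>
      ((((univ : Finset (Fin m)).filter fun i => ∀ j, g Ψ (Ψ i j).1 ≠ (Ψ i j).2).card : ℕ) : ℝ)) Φ :=
    fun Φ => Nat.cast_nonneg _
  have hνm : 0 < ν * m := by positivity
  have hε2 : 0 < ε / 2 := by positivity
  have hlt' : ε / 2 * (Fintype.card (Fin m → Fin k → Fin n × Bool) : ℝ)
      < (((univ : Finset (Fin m → Fin k → Fin n × Bool)).filter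
          fun Φ => ∀ i, ∃ j, g Φ (Φ i j).1 = (Φ i j).2).card : ℝ) := by
    have h2 : 0 < ε / 2 * N := by positivity
    have : ε / 2 * N < ε * N := by linarith only [h2]
    exact this.trans_le hsucc
  have hboost := shwLip_card_gt_le_of_zeroSet
    (fun Ψ : Fin m → Fin k → Fin n × Bool =>
      ((((univ : Finset (Fin m)).filter fun i => ∀ j, g Ψ (Ψ i j).1 ≠ (Ψ i j).2).card : ℕ) : ℝ))
    hV0 W (ε / 2) (ν * m) hε2 hνm (le_of_eq hWdef.symm) _ hZ hlt' hE1
  -- `Gᶜ = {ν m < V_g}`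
  have hset : Gᶜ = (univ : Finset (Fin m → Fin k → Fin n × Bool)).filter fun Φ =>
      ν * m < ((((univ : Finset (Fin m)).filter fun i =>
        ∀ j, g Φ (Φ i j).1 ≠ (Φ i j).2).card : ℕ) : ℝ) := by
    rw [hGdef, Finset.compl_filter]
    exact Finset.filter_congr fun Φ _ => by simp only [not_le]
  rw [hset]
  have hm0' : (m : ℝ) ≠ 0 := hmpos'.ne'
  have hν0 : ν ≠ 0 := hν.ne'
  have hrew : (k : ℝ) * m * (4 * (m * N * B) / (ν * m) ^ 2) = 4 * k * B / ν ^ 2 * N := by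
    field_simp
  calc _ ≤ ((k * m : ℕ) : ℝ) * (4 * W / (ν * m) ^ 2) :=
        mul_le_mul_of_nonneg_left hboost (Nat.cast_nonneg _)
    _ ≤ ((k * m : ℕ) : ℝ) * (4 * (m * N * B) / (ν * m) ^ 2) := by
        apply mul_le_mul_of_nonneg_left _ (Nat.cast_nonneg _)
        apply div_le_div_of_nonneg_right _ (by positivity)
        linarith only [hWB]
    _ = 4 * k * B / ν ^ 2 * N := by push_cast; exact hrew

end Boost

/-- **Numerics of the mean-square transfer at a large `n`.** With the explicit small constant `δ`
(`δ ≤ εν²α/(144k)`, `δ ≤ η²/(kα)`, `δ ≤ cν²/(576k³)`, `δ ≤ αν²/(288k)`), the bound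
`s₂ log³ n ≤ δ n` and three largeness conditions on `n ≥ 3`, at `m ∈ [αn - 1, αn]`: `m ≥ 1`, the jump
budget `s₂ · (m k) ≤ (η n)²`, the boost condition `8k(2 + 9 s₂ log² n) ≤ ε ν² m`, and the growing-loss
conditions `log 2 + 4kA log(2n) ≤ c n`, `4kA + 1 ≤ m k²` for the loss rate
`A = 4k·k(2 + 9 s₂ log² n)/ν² + 1`. -/
theorem sissMS_numerics (k : ℕ) (hk : 1 ≤ k) (α η ν ε c δ s₂ : ℝ) (hα : 0 < α)
    (hν : 0 < ν) (hε : 0 < ε) (hc : 0 < c) (hs0 : 0 ≤ s₂)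
    (hδa : δ ≤ ε * ν ^ 2 * α / (144 * k)) (hδη : δ ≤ η ^ 2 / (k * α))
    (hδc : δ ≤ c * ν ^ 2 / (576 * k ^ 3)) (hδb : δ ≤ α * ν ^ 2 / (288 * k))
    (n m : ℕ) (hn3 : 3 ≤ n)
    (hC1 : s₂ * Real.log n ^ 3 ≤ δ * n)
    (hC3 : (16 * k + ε * ν ^ 2) * 2 / (ε * ν ^ 2 * α) ≤ (n : ℝ))
    (hC4 : (1 + 64 * k ^ 3 / ν ^ 2 + 8 * k) * Real.log n ≤ c * n / 2)
    (hC5 : 2 * (32 * k ^ 3 / ν ^ 2 + 4 * k + 1 + k ^ 2) / (k ^ 2 * α) ≤ (n : ℝ))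
    (hm_ge : α * n - 1 ≤ m) (hm_le : (m : ℝ) ≤ α * n) :
    1 ≤ m ∧ s₂ * ((m * k : ℕ) : ℝ) ≤ (η * n) ^ 2 ∧
      8 * (k * (2 + 9 * Real.log n ^ 2 * s₂)) ≤ ε * ν ^ 2 * m ∧
      Real.log 2 + 4 * k * (4 * k * (k * (2 + 9 * Real.log n ^ 2 * s₂)) / ν ^ 2 + 1) *
          Real.log (2 * n) ≤ c * n ∧
      4 * k * (4 * k * (k * (2 + 9 * Real.log n ^ 2 * s₂)) / ν ^ 2 + 1) + 1
        ≤ ((m * k * k : ℕ) : ℝ) := by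
  have hkR : (1 : ℝ) ≤ k := by exact_mod_cast hk
  have hk0 : (0 : ℝ) < k := by linarith
  have hn1 : 1 ≤ n := le_trans (by norm_num) hn3
  have hnR : (1 : ℝ) ≤ n := by exact_mod_cast hn1
  have hn3R : (3 : ℝ) ≤ n := by exact_mod_cast hn3
  have hnpos : (0 : ℝ) < n := by linarith only [hnR]
  have hlog1 : 1 ≤ Real.log n := by
    rw [← Real.log_exp 1]
    apply Real.log_le_log (Real.exp_pos 1)
    have : Real.exp 1 ≤ 3 := le_of_lt (lt_trans Real.exp_one_lt_d9 (by norm_num))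
    exact this.trans hn3R
  have hlog2n : Real.log (2 * n) ≤ 2 * Real.log n := by
    rw [Real.log_mul two_ne_zero hnpos.ne']
    have : Real.log 2 ≤ Real.log n := Real.log_le_log two_pos (by linarith only [hn3R])
    linarith only [this]
  have hν2 : 0 < ν ^ 2 := by positivity
  -- `m ≥ 1`
  have hαn2 : 2 ≤ α * n := by
    have hpos : 0 < ε * ν ^ 2 * α := by positivity
    have h := hC3
    rw [div_le_iff₀ hpos] at h
    have hεν : 0 < ε * ν ^ 2 := by positivity
    have hk16 : 0 ≤ 16 * (k : ℝ) := by positivity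
    have key : ε * ν ^ 2 * 2 ≤ ε * ν ^ 2 * (α * n) := by nlinarith only [h, hεν, hk16]
    exact le_of_mul_le_mul_left key hεν
  have hmR : (1 : ℝ) ≤ m := by linarith only [hm_ge, hαn2]
  have hm1 : 1 ≤ m := by exact_mod_cast hmR
  -- sizes of `s₂`
  have hs'main : Real.log n ^ 2 * s₂ ≤ δ * n := by
    calc Real.log n ^ 2 * s₂ = s₂ * Real.log n ^ 2 := mul_comm _ _
      _ ≤ s₂ * Real.log n ^ 3 := by
          apply mul_le_mul_of_nonneg_left _ hs0
          exact pow_le_pow_right₀ hlog1 (by norm_num)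
      _ ≤ δ * n := hC1
  have hs'0 : s₂ ≤ δ * n := by
    calc s₂ = s₂ * 1 := (mul_one _).symm
      _ ≤ s₂ * Real.log n ^ 3 := mul_le_mul_of_nonneg_left (one_le_pow₀ hlog1) hs0
      _ ≤ δ * n := hC1
  -- the jump budget `s₂ (m k) ≤ (η n)²`
  have hjump : s₂ * ((m * k : ℕ) : ℝ) ≤ (η * n) ^ 2 := by
    push_cast
    have hkα : 0 < (k : ℝ) * α := by positivity
    have hδη' : δ * (k * α) ≤ η ^ 2 := by
      have h := hδη
      rw [le_div_iff₀ hkα] at h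
      exact h
    have hmk : (m : ℝ) * k ≤ α * n * k := mul_le_mul_of_nonneg_right hm_le hk0.le
    calc s₂ * ((m : ℝ) * k) ≤ s₂ * (α * n * k) := mul_le_mul_of_nonneg_left hmk hs0
      _ ≤ (δ * n) * (α * n * k) := mul_le_mul_of_nonneg_right hs'0 (by positivity)
      _ = (δ * (k * α)) * ((n : ℝ) ^ 2) := by ring
      _ ≤ η ^ 2 * ((n : ℝ) ^ 2) := mul_le_mul_of_nonneg_right hδη' (sq_nonneg _)
      _ = (η * n) ^ 2 := by ring
  set B : ℝ := k * (2 + 9 * Real.log n ^ 2 * s₂) with hB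
  have hBpos : 0 < B := by rw [hB]; positivity
  have hBbound : B ≤ 2 * k + 9 * k * (δ * n) := by
    rw [hB]
    have : 9 * (k : ℝ) * (Real.log n ^ 2 * s₂) ≤ 9 * k * (δ * n) :=
      mul_le_mul_of_nonneg_left hs'main (by positivity)
    nlinarith only [this]
  -- the boost condition
  have h8B : 8 * B ≤ ε * ν ^ 2 * m := by
    have hten : 72 * (k : ℝ) * (δ * n) ≤ ε * ν ^ 2 * α * n / 2 := by
      have hk2 : (0 : ℝ) < 144 * k := by positivity
      have h := hδa
      rw [le_div_iff₀ hk2] at h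
      have h' := mul_le_mul_of_nonneg_right h hnpos.le
      nlinarith only [h']
    have hC3' : 16 * k + ε * ν ^ 2 ≤ ε * ν ^ 2 * α * n / 2 := by
      have hpos : 0 < ε * ν ^ 2 * α := by positivity
      have h := hC3
      rw [div_le_iff₀ hpos] at h
      linarith only [h]
    have : ε * ν ^ 2 * (α * n - 1) ≤ ε * ν ^ 2 * m :=
      mul_le_mul_of_nonneg_left hm_ge (by positivity)
    nlinarith only [hBbound, hten, hC3', this]
  -- the growing-loss conditions, `A = 4 k B / ν² + 1`
  have ht : Real.log 2 + 4 * k * (4 * k * B / ν ^ 2 + 1) * Real.log (2 * n) ≤ c * n := by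
    have h1 : 4 * k * (4 * k * B / ν ^ 2 + 1) * Real.log (2 * n)
        ≤ (8 * k + 64 * k ^ 3 / ν ^ 2) * Real.log n + 288 * k ^ 3 / ν ^ 2 * (δ * n) := by
      have hstep : 4 * k * (4 * k * B / ν ^ 2 + 1) * Real.log (2 * n)
          ≤ 4 * k * (4 * k * B / ν ^ 2 + 1) * (2 * Real.log n) :=
        mul_le_mul_of_nonneg_left hlog2n (by positivity)
      have hexp : 4 * k * (4 * k * B / ν ^ 2 + 1) * (2 * Real.log n)
          = 8 * k * Real.log n + 32 * k ^ 2 / ν ^ 2 * (B * Real.log n) := by ring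
      have hBl : B * Real.log n ≤ 2 * k * Real.log n + 9 * k * (δ * n) := by
        have hBe : B * Real.log n = 2 * k * Real.log n + 9 * k * (s₂ * Real.log n ^ 3) := by
          rw [hB]; ring
        rw [hBe]
        have := mul_le_mul_of_nonneg_left hC1 (by positivity : (0 : ℝ) ≤ 9 * k)
        linarith only [this]
      have hfin : 32 * (k : ℝ) ^ 2 / ν ^ 2 * (B * Real.log n)
          ≤ 32 * k ^ 2 / ν ^ 2 * (2 * k * Real.log n + 9 * k * (δ * n)) :=
        mul_le_mul_of_nonneg_left hBl (by positivity)
      have hid : 32 * (k : ℝ) ^ 2 / ν ^ 2 * (2 * k * Real.log n + 9 * k * (δ * n))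
          = 64 * k ^ 3 / ν ^ 2 * Real.log n + 288 * k ^ 3 / ν ^ 2 * (δ * n) := by ring
      have hid2 : (8 * k + 64 * k ^ 3 / ν ^ 2) * Real.log n
          = 8 * k * Real.log n + 64 * (k : ℝ) ^ 3 / ν ^ 2 * Real.log n := by ring
      linarith only [hstep, hexp, hfin, hid, hid2]
    have h2 : (8 * k + 64 * k ^ 3 / ν ^ 2) * Real.log n ≤ c * n / 2 - Real.log 2 := by
      have hlog2 : Real.log 2 ≤ Real.log n := Real.log_le_log two_pos (by linarith only [hn3R])
      have : (1 + 64 * k ^ 3 / ν ^ 2 + 8 * k) * Real.log n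
          = Real.log n + (8 * k + 64 * k ^ 3 / ν ^ 2) * Real.log n := by ring
      linarith only [hC4, this, hlog2]
    have h3 : 288 * k ^ 3 / ν ^ 2 * (δ * n) ≤ c * n / 2 := by
      have hk4 : (0 : ℝ) < 576 * k ^ 3 := by positivity
      have h := hδc
      rw [le_div_iff₀ hk4] at h
      calc 288 * k ^ 3 / ν ^ 2 * (δ * n) = (288 * k ^ 3 * δ) * n / ν ^ 2 := by ring
        _ ≤ (c * ν ^ 2 / 2) * n / ν ^ 2 := by
            apply div_le_div_of_nonneg_right _ hν2.le
            apply mul_le_mul_of_nonneg_right _ hnpos.le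
            linarith only [h]
        _ = c * n / 2 := by field_simp
    linarith only [h1, h2, h3]
  have hMB : 4 * k * (4 * k * B / ν ^ 2 + 1) + 1 ≤ ((m * k * k : ℕ) : ℝ) := by
    have h1 : 4 * k * (4 * k * B / ν ^ 2 + 1) + 1
        ≤ 32 * k ^ 3 / ν ^ 2 + 4 * k + 1 + 144 * k ^ 3 / ν ^ 2 * (δ * n) := by
      have hexp : 4 * k * (4 * k * B / ν ^ 2 + 1) + 1 = 16 * k ^ 2 / ν ^ 2 * B + 4 * k + 1 := by ring
      rw [hexp]
      have : 16 * (k : ℝ) ^ 2 / ν ^ 2 * B ≤ 16 * k ^ 2 / ν ^ 2 * (2 * k + 9 * k * (δ * n)) :=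
        mul_le_mul_of_nonneg_left hBbound (by positivity)
      have hrhs : 16 * (k : ℝ) ^ 2 / ν ^ 2 * (2 * k + 9 * k * (δ * n))
          = 32 * k ^ 3 / ν ^ 2 + 144 * k ^ 3 / ν ^ 2 * (δ * n) := by ring
      linarith only [this, hrhs]
    have h2 : 144 * k ^ 3 / ν ^ 2 * (δ * n) ≤ k ^ 2 * (α * n) / 2 := by
      have hk3 : (0 : ℝ) < 288 * k := by positivity
      have h := hδb
      rw [le_div_iff₀ hk3] at h
      have hk2 : (0 : ℝ) ≤ k ^ 2 := sq_nonneg _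
      calc 144 * k ^ 3 / ν ^ 2 * (δ * n) = k ^ 2 * ((144 * k * δ) * n) / ν ^ 2 := by ring
        _ ≤ k ^ 2 * ((α * ν ^ 2 / 2) * n) / ν ^ 2 := by
            apply div_le_div_of_nonneg_right _ hν2.le
            apply mul_le_mul_of_nonneg_left _ hk2
            apply mul_le_mul_of_nonneg_right _ hnpos.le
            linarith only [h]
        _ = k ^ 2 * (α * n) / 2 := by field_simp
    have h3 : 32 * k ^ 3 / ν ^ 2 + 4 * k + 1 + k ^ 2 ≤ k ^ 2 * (α * n) / 2 := by
      have hpos : (0 : ℝ) < k ^ 2 * α := by positivity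
      have h := hC5
      rw [div_le_iff₀ hpos] at h
      linarith only [h]
    have h4 : ((m * k * k : ℕ) : ℝ) ≥ k ^ 2 * (α * n) - k ^ 2 := by
      push_cast
      have := mul_le_mul_of_nonneg_right hm_ge (show (0 : ℝ) ≤ k * k by positivity)
      linarith only [this]
    linarith only [h1, h2, h3, h4]
  refine ⟨hm1, hjump, ?_, ht, hMB⟩
  rw [hB] at h8B
  exact h8B

end Summit.PneNP.PneNP.Theorems
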